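import Literature.AnabelianGeometry.AbsoluteAnabelian.AutHolomorphicSpacesHolTypeProofs
import Literature.AnabelianGeometry.AbsoluteAnabelian.AutHolomorphicSpacesTransportProofs
import Literature.AnabelianGeometry.AbsoluteAnabelian.RCHolomorphicCalculus
import HarnessLib

/-!
# RC-holomorphic maps: from open subsets back to the ambient surfaces; locally injective maps

PROOF-ONLY companion (no new definitions, no new named facts) of `AutHolomorphicSpaces.lean`
([AbsTopIII] Def. 2.1 (ii), S. Mochizuki, *Topics in absolute anabelian geometry III*, §2, kurims
p. 51: holomorphic / anti-holomorphic points, RC-holomorphic maps).  abc-iut cell, seat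
abc-iut-w5-d053 (sub-DAG [AbsTopIII] Cor 2.7 (b), row Cor-27.b.r10 (b).8).  Converses / variants of
lemmas of abc-iut-L4-t8 (`IsHolAt.restrict_opens`, `RemarksArchimedeanLocalProofs`) and abc-iut-L4-t7
(`not_isHolAt_and_isAntiHolAt`, `forall_isHolAt_or_forall_isAntiHolAt`,
`AutHolomorphicSpacesHolTypeProofs`):

* `IsHolAt.of_restrict_opens`, `IsAntiHolAt.of_restrict_opens` (with a private continuity helper) — if the restriction `e : U → V` of
  `φ : X → Y` to opens is (anti-)holomorphic at `x`, so is `φ` at `x`;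
* `not_isHolAt_and_isAntiHolAt_of_injOn` — a continuous map of Riemann surfaces injective on a
  neighbourhood of `p` is not both holomorphic and anti-holomorphic at `p`;
* `forall_isHolAt_or_forall_isAntiHolAt_of_injOn` — on an open preconnected set where such a map is
  RC-holomorphic and locally injective, its type is constant.

Refereed pre-IUT material; nothing here bears on the disputed [IUTchIII] Cor. 3.12; no side taken.
-/

noncomputable section

namespace Literature.AnabelianGeometry.AbsoluteAnabelian

universe u

open _root_.TopologicalSpace _root_.Topology _root_.Set _root_.Metric _root_.Function _root_.Filter
open scoped _root_.Manifold _root_.ContDiff ComplexConjugate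

/-! ### From opens back to the ambient spaces -/

section Restrict

variable {X Y : Type u} [TopologicalSpace X] [ChartedSpace ℂ X] [TopologicalSpace Y]
  [ChartedSpace ℂ Y]

/-- If the restriction `e : U → V` of `φ : X → Y` to opens is holomorphic at `x ∈ U`, then `φ` is
holomorphic at `x` (converse of `IsHolAt.restrict_opens`). [cite: MochizukiAbsTopIII2015, Definition 2.1 (ii) p.51] -/
theorem IsHolAt.of_restrict_opens {U : Opens X} {V : Opens Y} {φ : X → Y} {e : U → V}
    (he : ∀ x : U, (e x : Y) = φ x) {x : U} (h : IsHolAt e x) : IsHolAt φ (x : X) := by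
  have h' : ∀ᶠ y : U in 𝓝 x, MDifferentiableAt 𝓘(ℂ, ℂ) 𝓘(ℂ, ℂ) φ (y : X) := by
    filter_upwards [h] with y hy
    exact (mdifferentiableAt_opens_iff (U := U) (V := V) (Φ := φ) (Ψ := e) he y).1 hy
  rw [IsHolAt, ← U.isOpenEmbedding'.map_nhds_eq x, Filter.eventually_map]
  exact h'

omit [ChartedSpace ℂ X] [ChartedSpace ℂ Y] in
/-- Continuity at a point of an open passes to the ambient map. [folklore] -/
private theorem continuousAt_of_restrict_opens {U : Opens X} {V : Opens Y} {φ : X → Y} {e : U → V}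
    (he : ∀ x : U, (e x : Y) = φ x) {y : U} (hc : ContinuousAt e y) : ContinuousAt φ (y : X) := by
  have h1 : ContinuousAt (fun z : U => ((e z : V) : Y)) y := continuous_subtype_val.continuousAt.comp hc
  have h2 : (fun z : U => ((e z : V) : Y)) = φ ∘ Subtype.val := funext he
  rw [h2] at h1
  exact (U.isOpenEmbedding'.continuousAt_iff).1 h1

/-- If the restriction `e : U → V` of `φ : X → Y` to opens is anti-holomorphic at `x ∈ U`, then `φ` is
anti-holomorphic at `x` (converse of `IsAntiHolAt.restrict_opens`; the chart expressions of `e` and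
`φ` agree near the base point). [cite: MochizukiAbsTopIII2015, Definition 2.1 (ii) p.51] -/
theorem IsAntiHolAt.of_restrict_opens {U : Opens X} {V : Opens Y} {φ : X → Y} {e : U → V}
    (he : ∀ x : U, (e x : Y) = φ x) {x : U} (h : IsAntiHolAt e x) : IsAntiHolAt φ (x : X) := by
  have h' : ∀ᶠ y : U in 𝓝 x, ContinuousAt φ (y : X) ∧
      DifferentiableAt ℂ (conj ∘ writtenInExtChartAt 𝓘(ℂ, ℂ) 𝓘(ℂ, ℂ) (y : X) φ)
        (extChartAt 𝓘(ℂ, ℂ) (y : X) y) := by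
    filter_upwards [h] with y hy
    obtain ⟨hc, hd⟩ := hy
    refine ⟨continuousAt_of_restrict_opens he hc, ?_⟩
    set cX := chartAt ℂ (y : X) with hcX
    set cY := chartAt ℂ (φ y) with hcY
    have hpt : extChartAt 𝓘(ℂ, ℂ) y y = cX y := by
      rw [extChartAt_apply_eq, hcX]
      rfl
    have hpt' : extChartAt 𝓘(ℂ, ℂ) (y : X) y = cX y := by simp [hcX]
    have hW : ∀ w, writtenInExtChartAt 𝓘(ℂ, ℂ) 𝓘(ℂ, ℂ) (y : X) φ w = cY (φ (cX.symm w)) :=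
        fun w => by
      simp [writtenInExtChartAt, hcX, hcY]
    have hWe : ∀ w, writtenInExtChartAt 𝓘(ℂ, ℂ) 𝓘(ℂ, ℂ) y e w =
        chartAt ℂ ((e y : V) : Y) (((e ((chartAt ℂ y).symm w)) : V) : Y) := fun w => by
      rw [writtenInExtChartAt_apply_eq]
      rfl
    have hey : ((e y : V) : Y) = φ y := he y
    have hev : writtenInExtChartAt 𝓘(ℂ, ℂ) 𝓘(ℂ, ℂ) y e =ᶠ[𝓝 (cX y)]
        writtenInExtChartAt 𝓘(ℂ, ℂ) 𝓘(ℂ, ℂ) (y : X) φ := by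
      have hsymm := TopologicalSpace.Opens.chartAt_subtype_val_symm_eventuallyEq (H := ℂ) U (x := y)
      filter_upwards [hsymm] with w hw
      rw [hWe, hW, hey, hcY, hcX, he]
      congr 2
      rw [hw]
      rfl
    rw [hpt']
    rw [hpt] at hd
    exact ((hev.fun_comp conj).differentiableAt_iff).1 hd
  rw [IsAntiHolAt, ← U.isOpenEmbedding'.map_nhds_eq x, Filter.eventually_map]
  exact h'

end Restrict

/-! ### Locally injective maps: the two types exclude each other -/

section Types

variable {X Y : Type u} [TopologicalSpace X] [ChartedSpace ℂ X] [IsManifold 𝓘(ℂ, ℂ) ω X]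
  [TopologicalSpace Y] [ChartedSpace ℂ Y] [IsManifold 𝓘(ℂ, ℂ) ω Y]

/-- **Holomorphic and anti-holomorphic points exclude each other for locally injective maps**: a
continuous map of Riemann surfaces injective on an open neighbourhood of `p` is not both holomorphic
and anti-holomorphic at `p` (same proof as abc-iut-L4-t7's homeomorphism version: the chart expression
is injective near the base point, hence has non-vanishing derivative, while a map differentiable
together with its conjugate has derivative zero). [cite: MochizukiAbsTopIII2015, Definition 2.1 (ii) p.51] -/
theorem not_isHolAt_and_isAntiHolAt_of_injOn {φ : X → Y} (hφ : Continuous φ) {p : X} {N : Set X}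
    (hN : IsOpen N) (hpN : p ∈ N) (hinj : InjOn φ N) : ¬ (IsHolAt φ p ∧ IsAntiHolAt φ p) := by
  rintro ⟨hhol, hanti⟩
  set cX := chartAt ℂ p with hcX
  set cY := chartAt ℂ (φ p) with hcY
  set T := writtenInExtChartAt 𝓘(ℂ, ℂ) 𝓘(ℂ, ℂ) p φ with hT
  have hw : extChartAt 𝓘(ℂ, ℂ) p p = cX p := by simp [hcX]
  -- `T` differentiable near `cX p`, `conj ∘ T` differentiable at `cX p`
  have h1 : ∀ᶠ w in 𝓝 (cX p), DifferentiableAt ℂ T w := by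
    have := eventually_differentiableAt_writtenInExtChartAt hφ.continuousAt hhol
    rwa [hw] at this
  have h2 : DifferentiableAt ℂ (conj ∘ T) (cX p) := by
    have := (hanti.self_of_nhds).2
    rwa [hw] at this
  -- `T` is injective near `cX p`
  have hTdef : ∀ w, T w = cY (φ (cX.symm w)) := fun w => by
    simp [hT, writtenInExtChartAt, hcX, hcY]
  set O : Set ℂ := cX.target ∩ cX.symm ⁻¹' (N ∩ φ ⁻¹' cY.source) with hO
  have hOo : IsOpen O :=
    cX.symm.isOpen_inter_preimage (hN.inter (cY.open_source.preimage hφ))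
  have hpO : cX p ∈ O := by
    refine ⟨mem_chart_target ℂ p, ?_⟩
    show cX.symm (cX p) ∈ N ∩ φ ⁻¹' cY.source
    rw [cX.left_inv (mem_chart_source ℂ p)]
    exact ⟨hpN, mem_chart_source ℂ (φ p)⟩
  have hinjT : InjOn T O := by
    intro w hw' w' hw'' hww
    rw [hTdef, hTdef] at hww
    have h3 : φ (cX.symm w) = φ (cX.symm w') := cY.injOn hw'.2.2 hw''.2.2 hww
    have h4 : cX.symm w = cX.symm w' := hinj hw'.2.1 hw''.2.1 h3
    exact cX.symm.injOn hw'.1 hw''.1 h4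
  -- a ball on which `T` is differentiable and injective
  obtain ⟨ε, hε, hball⟩ := Metric.isOpen_iff.1 hOo (cX p) hpO
  obtain ⟨δ, hδ, hballd⟩ := Metric.eventually_nhds_iff_ball.1 h1
  set r := min ε δ with hr
  have hr0 : 0 < r := lt_min hε hδ
  have hdiff : DifferentiableOn ℂ T (ball (cX p) r) := fun w hw' =>
    (hballd w (ball_subset_ball (min_le_right _ _) hw')).differentiableWithinAt
  have hinj' : InjOn T (ball (cX p) r) :=
    hinjT.mono ((ball_subset_ball (min_le_left _ _)).trans hball)
  have hne := Literature.Analysis.Complex.SCV.deriv_ne_zero_of_injOn hdiff isOpen_ball hinj'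
    (mem_ball_self hr0)
  exact hne (deriv_eq_zero_of_differentiableAt_conj_comp (hdiff.differentiableAt
    (isOpen_ball.mem_nhds (mem_ball_self hr0))) h2)

/-- **On an open preconnected set the type of a locally injective RC-holomorphic map is constant**:
either holomorphic at every point of `W` or anti-holomorphic at every point of `W`.
[cite: MochizukiAbsTopIII2015, Corollary 2.3 (i) p.53] -/
theorem forall_isHolAt_or_forall_isAntiHolAt_of_injOn {φ : X → Y} (hφ : Continuous φ) {W : Set X}
    (hWo : IsOpen W) (hW : IsPreconnected W)
    (hinj : ∀ p ∈ W, ∃ N : Set X, IsOpen N ∧ p ∈ N ∧ InjOn φ N)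
    (hrc : ∀ p ∈ W, IsHolAt φ p ∨ IsAntiHolAt φ p) :
    (∀ p ∈ W, IsHolAt φ p) ∨ ∀ p ∈ W, IsAntiHolAt φ p := by
  have hsub : W ⊆ (W ∩ {p | IsHolAt φ p}) ∪ (W ∩ {p | IsAntiHolAt φ p}) := fun p hp =>
    (hrc p hp).imp (fun h => ⟨hp, h⟩) (fun h => ⟨hp, h⟩)
  have hdisj : Disjoint (W ∩ {p | IsHolAt φ p}) (W ∩ {p | IsAntiHolAt φ p}) :=
    Set.disjoint_left.2 fun p h1 h2 => by
      obtain ⟨N, hN, hpN, hi⟩ := hinj p h1.1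
      exact not_isHolAt_and_isAntiHolAt_of_injOn hφ hN hpN hi ⟨h1.2, h2.2⟩
  rcases hW.subset_or_subset (hWo.inter (isOpen_setOf_isHolAt _))
      (hWo.inter (isOpen_setOf_isAntiHolAt _)) hdisj hsub with h | h
  · exact Or.inl fun p hp => (h hp).2
  · exact Or.inr fun p hp => (h hp).2

end Types

end Literature.AnabelianGeometry.AbsoluteAnabelian
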